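import Summits.QuantumFields.YangMills.Theorems.FluctuationComparisonRegPrIntLS2BetaFibreTransport
import Literature.MathematicalPhysics.QuantumFieldTheory.Balaban1983to89.B16Thm1BaseAtRecord11
import HarnessLib

/-!
# THE PER-DATUM FIBRE GAP FROM «ACHIEVERS ON ONE ORBIT» AND «LOCAL MORSE–BOTT GROWTH», BY COMPACTNESS — GAP♭(V,U₀) ⟸ ORB̄(V,U₀) ∧ MB(V,U₀)
# (crux `FluctuationComparisonRegPrIntL`, stmt-QuantumFields-20520; registry v11.4 `Cruxes/FluctuationComparisonRegPrIntL/Lines/semiclassical_s2beta.lean` 3732b7df, organ GAP♯∘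
# `UniformFibreGapOrbit` l.768; px17 g14 FINDING Q-GAP♯-UNIFORMITY a52e0050 + CERTs 8e6b4fe2 ∕ 603780ac: the registry's consumers read GAP♯∘ only as the PER-DATUM,
# PER-BASE-POINT statement GAP♭; UV3-NODE §37.5)

Cell `ym3-torus` (YM ladder rung R3 = continuum `SU(2)` Yang–Mills on the three-torus — a RUNG, NOT d = 4, NOT infinite volume, NOT a mass gap, NOT Clay); width seat `ym3-torus-px17`
(gen 14), ORB side of the GAP♯ division; `--supports stmt-QuantumFields-20520 --as helper`, count-neutral, definition-free, default heartbeats.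

WHAT.  At ONE datum `V` (run `K`, height `J`) and ONE base point `U₀`, write `g U := ⨅_{w residual} Σ_ℓ dist1 (U ℓ · (w • U₀)ℓ⁻¹)²` (the residual-orbit distance of GAP♯∘,
continuous in `U`: ✓`continuous_iInf_orbitDistSq`) and `f U := wilsonAction4 U − minActionRegPr F J K hJK ε₀ V` (continuous: lit ✓`continuous_wilsonAction4_SU`).  TWO LETTERS:
* ORB̄(V,U₀): every field in the CLOSURE of the good-history fibre `fibre V ∩ histGood(θBal b₀) K J` whose action is `≤` the (6)-minimum is a residual translate of `U₀`
  (the qualitative «achievers on one orbit» letter, closed-window form — REG-ARGMIN̄ + [Balaban1985Variational] Prop. 7 cl.1; unprinted at depth `(1−1∕m)K`, UV3-NODE §37);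
* MB(V,U₀): local quadratic growth near the orbit — `∃ δ μ₀ > 0, ∀ U ∈ fibre V ∩ histGood, g U < δ → μ₀ · g U ≤ f U` (non-degeneracy of the constrained Hessian modulo gauge at the orbit,
  [Balaban1985Variational] (142) read QUALITATIVELY — any constants).
★★ `gapFlatAt_of_orbBar_of_morseBott`: ORB̄ ∧ MB ⇒ `∃ μ > 0, ∀ U ∈ fibre V, U ∈ histGood → μ·L^{−2(K−J)}·g U ≤ f U` — EXACTLY the inner text of GAP♭ (CERT 603780ac l.771–776, RG-K
substitutions), hence of GAP♯∘ at `(V, U₀)` with a datum-dependent modulus.  PROOF = finite-dimensional compactness: `SU(2)^{bonds}` is compact (lit ✓`T3OrbitAverage` scoped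
instances); on the compact set `S := closure(fibre ∩ histGood) ∩ {δ ≤ g}` the excess `f` is positive (a zero would be a closed-window achiever off the orbit — ORB̄ puts it ON the orbit, where
`g = 0 < δ`, ✓`iInf_orbitDistSq_eq_zero_of_residual`), so `f ≥ m > 0` there (`IsCompact.exists_isMinOn`), while `g ≤ D` on the whole space (`IsCompact.exists_isMaxOn`); `μ := min μ₀ (m∕D)`
(rescaled by `L^{2(K−J)}`).  Also: ★`excess_nonneg_of_orbBar_of_morseBott` (EXW∘ clause (1) at the datum is a COROLLARY: `minActionRegPr ≤ A` on the good-history fibre), and the letters'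
trivial converses `orbBar_isOnOrbit_of_gapFlatAt`-type bookkeeping is NOT claimed (GAP♭ speaks of the open fibre only).

NET (CREDIT NOTHING): with the FINDING's CERTs, the analytic content of the registry organ GAP♯∘ AS CONSUMED is reduced BY KERNEL to the two per-datum qualitative letters ORB̄ and MB —
no uniformity in `K`, `V` or `U₀`, no sup-tube for all good histories, no (1.33)-uniform modulus.  HONEST: ORB̄ (unprinted at depth) and MB ((142) qualitative, at every interior datum)
are HYPOTHESES here; GAP♭∕GAP♯∘∕EXW∘∕S2β∕20520, EX (19200) NOT proved; registry №36 untouched; rung R3 = SU(2) YM₃ on T³ — NOT d = 4, NOT infinite volume, NOT a mass gap, NOT Clay.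
Sorry-free, axioms standard.

References: T. Bałaban, CMP **102** (1985) 277–309 [Balaban1985Variational] (Thm 1 (8)-(10) p.279, Prop. 7 and (142) p.299); CMP **109** (1987) 249–301 [Balaban1987RG1] ((0.2) p.252).
-/

set_option autoImplicit false

noncomputable section

namespace Summit.QuantumFields.YangMills.Theorems.FluctuationComparisonRegPrIntLGapFlatOfOrbBarMorseBott

open Set Filter Topology
open Literature.MathematicalPhysics.QuantumFieldTheory.Balaban1983to89
open Literature.MathematicalPhysics.QuantumFieldTheory.Balaban1983to89.T3ContinuumYM3Torus
open Literature.MathematicalPhysics.QuantumFieldTheory.Balaban1983to89.T3UnitLawDensityEML (ℰp)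
open Literature.MathematicalPhysics.QuantumFieldTheory.Balaban1983to89.T3UnitScaleTilt
open Literature.MathematicalPhysics.QuantumFieldTheory.Balaban1983to89.T3TiltDescent
open Literature.MathematicalPhysics.QuantumFieldTheory.Balaban1983to89.T3ConstrainedMinimiser (fibre)
open Literature.MathematicalPhysics.QuantumFieldTheory.Balaban1983to89.T3PrintedRegularMinimiser
open Literature.MathematicalPhysics.QuantumFieldTheory.Balaban1983to89.T4Continuum
open scoped Literature.MathematicalPhysics.QuantumFieldTheory.Balaban1983to89.T3OrbitAverage
open Summit.QuantumFields.YangMills.Theorems.FluctuationComparisonRegPrIntLS2BetaResidualGauge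
open Summit.QuantumFields.YangMills.Theorems.FluctuationComparisonRegPrIntLS2BetaResidualGaugeOrbit
open Summit.QuantumFields.YangMills.Theorems.FluctuationComparisonRegPrIntLS2BetaFibreTransport

section Door

variable (F : T3Family) {J K : ℕ} (hJK : J ≤ K) {γ b₀ p₀ ε₀ : ℝ}

/-- ★★ **GAP♭ AT ONE DATUM AND ONE BASE POINT ⟸ ORB̄ ∧ MB, BY COMPACTNESS.**  `hOrb` = ORB̄(V,U₀) (closed-window achievers are residual translates of `U₀`), `hMB` = MB(V,U₀) (local
quadratic growth where the orbit distance is `< δ`); conclusion = GAP♭'s inner text at `(V, U₀)`: a positive modulus `μ` with `μ·L^{−2(K−J)}·⨅_w Σ dist1² ≤ A − min` for every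
good-history field over `V`. [cite: Balaban1985Variational, Prop. 7 and (142) p.299] -/
theorem gapFlatAt_of_orbBar_of_morseBott
    (V : GaugeField (F.P J) 0 (Matrix.specialUnitaryGroup (Fin 2) ℂ)) (U₀ : GaugeField (F.P K) 0 (Matrix.specialUnitaryGroup (Fin 2) ℂ))
    (hOrb : ∀ U ∈ closure (fibre F ℰp J K hJK V ∩ histGood F ℰp (θBal F.L γ b₀ p₀) K J),
      wilsonAction4 U ≤ minActionRegPr F J K hJK ε₀ V →
        ∃ w : Site (F.P K) 0 → Matrix.specialUnitaryGroup (Fin 2) ℂ,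
          (∀ U' : GaugeField (F.P K) 0 (Matrix.specialUnitaryGroup (Fin 2) ℂ),
              descendTo F ℰp J K hJK (GaugeField.gaugeAct w U') = descendTo F ℰp J K hJK U') ∧
            U = GaugeField.gaugeAct w U₀)
    (hMB : ∃ δ μ₀ : ℝ, 0 < δ ∧ 0 < μ₀ ∧ ∀ U ∈ fibre F ℰp J K hJK V, U ∈ histGood F ℰp (θBal F.L γ b₀ p₀) K J →
      (⨅ w : {w : Site (F.P K) 0 → Matrix.specialUnitaryGroup (Fin 2) ℂ |
          ∀ U : GaugeField (F.P K) 0 (Matrix.specialUnitaryGroup (Fin 2) ℂ),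
            descendTo F ℰp J K hJK (GaugeField.gaugeAct w U) = descendTo F ℰp J K hJK U},
        ∑ ℓ : PBond (F.P K) 0,
          dist1 (U ℓ * ((GaugeField.gaugeAct (w : Site (F.P K) 0 → Matrix.specialUnitaryGroup (Fin 2) ℂ) U₀) ℓ)⁻¹) ^ 2) < δ →
      μ₀ * (⨅ w : {w : Site (F.P K) 0 → Matrix.specialUnitaryGroup (Fin 2) ℂ |
          ∀ U : GaugeField (F.P K) 0 (Matrix.specialUnitaryGroup (Fin 2) ℂ),
            descendTo F ℰp J K hJK (GaugeField.gaugeAct w U) = descendTo F ℰp J K hJK U},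
        ∑ ℓ : PBond (F.P K) 0,
          dist1 (U ℓ * ((GaugeField.gaugeAct (w : Site (F.P K) 0 → Matrix.specialUnitaryGroup (Fin 2) ℂ) U₀) ℓ)⁻¹) ^ 2)
        ≤ wilsonAction4 U - minActionRegPr F J K hJK ε₀ V) :
    ∃ μ : ℝ, 0 < μ ∧ ∀ U ∈ fibre F ℰp J K hJK V, U ∈ histGood F ℰp (θBal F.L γ b₀ p₀) K J →
      μ * ((F.L : ℝ)⁻¹) ^ (2 * (K - J)) *
          (⨅ w : {w : Site (F.P K) 0 → Matrix.specialUnitaryGroup (Fin 2) ℂ |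
              ∀ U : GaugeField (F.P K) 0 (Matrix.specialUnitaryGroup (Fin 2) ℂ),
                descendTo F ℰp J K hJK (GaugeField.gaugeAct w U) = descendTo F ℰp J K hJK U},
            ∑ ℓ : PBond (F.P K) 0,
              dist1 (U ℓ * ((GaugeField.gaugeAct (w : Site (F.P K) 0 → Matrix.specialUnitaryGroup (Fin 2) ℂ) U₀) ℓ)⁻¹) ^ 2)
        ≤ wilsonAction4 U - minActionRegPr F J K hJK ε₀ V := by
  classical
  -- notation-free abbreviations
  set g : GaugeField (F.P K) 0 (Matrix.specialUnitaryGroup (Fin 2) ℂ) → ℝ := fun U =>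
    ⨅ w : {w : Site (F.P K) 0 → Matrix.specialUnitaryGroup (Fin 2) ℂ |
        ∀ U : GaugeField (F.P K) 0 (Matrix.specialUnitaryGroup (Fin 2) ℂ),
          descendTo F ℰp J K hJK (GaugeField.gaugeAct w U) = descendTo F ℰp J K hJK U},
      ∑ ℓ : PBond (F.P K) 0,
        dist1 (U ℓ * ((GaugeField.gaugeAct (w : Site (F.P K) 0 → Matrix.specialUnitaryGroup (Fin 2) ℂ) U₀) ℓ)⁻¹) ^ 2 with hg_def
  set f : GaugeField (F.P K) 0 (Matrix.specialUnitaryGroup (Fin 2) ℂ) → ℝ := fun U =>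
    wilsonAction4 U - minActionRegPr F J K hJK ε₀ V with hf_def
  have hgc : Continuous g := continuous_iInf_orbitDistSq F hJK U₀
  have hfc : Continuous f := (B16Thm1BaseAtRecord11.continuous_wilsonAction4_SU (N := 2) (F.P K) 0).sub continuous_const
  have hg0 : ∀ U, 0 ≤ g U := fun U => Real.iInf_nonneg fun w => Finset.sum_nonneg fun ℓ _ => sq_nonneg _
  have hLpos : (0 : ℝ) < (F.L : ℝ) := Nat.cast_pos.mpr (lt_trans zero_lt_one F.hL.2)
  have hη : 0 < ((F.L : ℝ)⁻¹) ^ (2 * (K - J)) := pow_pos (inv_pos.mpr hLpos) _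
  obtain ⟨δ, μ₀, hδ, hμ₀, hMB⟩ := hMB
  -- the far region: closure of the good fibre with orbit distance `≥ δ` — compact, and the excess is positive there
  set W : Set (GaugeField (F.P K) 0 (Matrix.specialUnitaryGroup (Fin 2) ℂ)) :=
    fibre F ℰp J K hJK V ∩ histGood F ℰp (θBal F.L γ b₀ p₀) K J with hW_def
  set S : Set (GaugeField (F.P K) 0 (Matrix.specialUnitaryGroup (Fin 2) ℂ)) := closure W ∩ {U | δ ≤ g U} with hS_def
  have hScl : IsClosed S := isClosed_closure.inter (isClosed_le continuous_const hgc)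
  have hScpt : IsCompact S := hScl.isCompact
  have hfpos : ∀ U ∈ S, 0 < f U := by
    intro U hU
    by_contra hle
    have hle' : wilsonAction4 U ≤ minActionRegPr F J K hJK ε₀ V := by
      have : f U ≤ 0 := not_lt.mp hle
      simp only [hf_def] at this
      linarith
    obtain ⟨w, hw, hUw⟩ := hOrb U hU.1 hle'
    have hg0U : g U = 0 := by
      simp only [hg_def, hUw]
      exact iInf_orbitDistSq_eq_zero_of_residual F hJK hw U₀
    have hδle : δ ≤ g U := hU.2
    linarith
  -- a global bound for `g` (compact space)
  obtain ⟨D, hD⟩ : ∃ D : ℝ, ∀ U, g U ≤ D := by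
    obtain ⟨Umax, -, hmax⟩ := isCompact_univ.exists_isMaxOn univ_nonempty hgc.continuousOn
    exact ⟨g Umax, fun U => hmax (mem_univ U)⟩
  have hDpos : 0 < max D δ := lt_max_of_lt_right hδ
  -- the modulus
  by_cases hSne : S.Nonempty
  · obtain ⟨Umin, hUminS, hmin⟩ := hScpt.exists_isMinOn hSne hfc.continuousOn
    have hm : 0 < f Umin := hfpos Umin hUminS
    refine ⟨min μ₀ (f Umin / max D δ) / ((F.L : ℝ)⁻¹) ^ (2 * (K - J)),
      div_pos (lt_min hμ₀ (div_pos hm hDpos)) hη, fun U hUf hUg => ?_⟩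
    rw [div_mul_cancel₀ _ hη.ne']
    by_cases hnear : g U < δ
    · exact (mul_le_mul_of_nonneg_right (min_le_left _ _) (hg0 U)).trans (hMB U hUf hUg hnear)
    · have hUS : U ∈ S := ⟨subset_closure ⟨hUf, hUg⟩, not_lt.mp hnear⟩
      have hfU : f Umin ≤ f U := hmin hUS
      have hgD : g U ≤ max D δ := (hD U).trans (le_max_left _ _)
      calc min μ₀ (f Umin / max D δ) * g U ≤ (f Umin / max D δ) * g U :=
            mul_le_mul_of_nonneg_right (min_le_right _ _) (hg0 U)
        _ ≤ (f Umin / max D δ) * max D δ := mul_le_mul_of_nonneg_left hgD (div_pos hm hDpos).le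
        _ = f Umin := div_mul_cancel₀ _ hDpos.ne'
        _ ≤ f U := hfU
  · -- no far region: every good-history field is `δ`-close to the orbit
    refine ⟨μ₀ / ((F.L : ℝ)⁻¹) ^ (2 * (K - J)), div_pos hμ₀ hη, fun U hUf hUg => ?_⟩
    rw [div_mul_cancel₀ _ hη.ne']
    have hnear : g U < δ := by
      by_contra h
      exact hSne ⟨U, subset_closure ⟨hUf, hUg⟩, not_lt.mp h⟩
    exact hMB U hUf hUg hnear

/-- ★ **EXW∘ CLAUSE (1) AT THE DATUM IS A COROLLARY**: under ORB̄ ∧ MB the (6)-minimum bounds the action of every good-history field from below. [cite: Balaban1985Variational, Thm 1 (8) p.279] -/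
theorem excess_nonneg_of_orbBar_of_morseBott
    (V : GaugeField (F.P J) 0 (Matrix.specialUnitaryGroup (Fin 2) ℂ)) (U₀ : GaugeField (F.P K) 0 (Matrix.specialUnitaryGroup (Fin 2) ℂ))
    (hOrb : ∀ U ∈ closure (fibre F ℰp J K hJK V ∩ histGood F ℰp (θBal F.L γ b₀ p₀) K J),
      wilsonAction4 U ≤ minActionRegPr F J K hJK ε₀ V →
        ∃ w : Site (F.P K) 0 → Matrix.specialUnitaryGroup (Fin 2) ℂ,
          (∀ U' : GaugeField (F.P K) 0 (Matrix.specialUnitaryGroup (Fin 2) ℂ),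
              descendTo F ℰp J K hJK (GaugeField.gaugeAct w U') = descendTo F ℰp J K hJK U') ∧
            U = GaugeField.gaugeAct w U₀)
    (hMB : ∃ δ μ₀ : ℝ, 0 < δ ∧ 0 < μ₀ ∧ ∀ U ∈ fibre F ℰp J K hJK V, U ∈ histGood F ℰp (θBal F.L γ b₀ p₀) K J →
      (⨅ w : {w : Site (F.P K) 0 → Matrix.specialUnitaryGroup (Fin 2) ℂ |
          ∀ U : GaugeField (F.P K) 0 (Matrix.specialUnitaryGroup (Fin 2) ℂ),
            descendTo F ℰp J K hJK (GaugeField.gaugeAct w U) = descendTo F ℰp J K hJK U},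
        ∑ ℓ : PBond (F.P K) 0,
          dist1 (U ℓ * ((GaugeField.gaugeAct (w : Site (F.P K) 0 → Matrix.specialUnitaryGroup (Fin 2) ℂ) U₀) ℓ)⁻¹) ^ 2) < δ →
      μ₀ * (⨅ w : {w : Site (F.P K) 0 → Matrix.specialUnitaryGroup (Fin 2) ℂ |
          ∀ U : GaugeField (F.P K) 0 (Matrix.specialUnitaryGroup (Fin 2) ℂ),
            descendTo F ℰp J K hJK (GaugeField.gaugeAct w U) = descendTo F ℰp J K hJK U},
        ∑ ℓ : PBond (F.P K) 0,
          dist1 (U ℓ * ((GaugeField.gaugeAct (w : Site (F.P K) 0 → Matrix.specialUnitaryGroup (Fin 2) ℂ) U₀) ℓ)⁻¹) ^ 2)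
        ≤ wilsonAction4 U - minActionRegPr F J K hJK ε₀ V) :
    ∀ U ∈ fibre F ℰp J K hJK V, U ∈ histGood F ℰp (θBal F.L γ b₀ p₀) K J → minActionRegPr F J K hJK ε₀ V ≤ wilsonAction4 U := by
  obtain ⟨μ, hμ, h⟩ := gapFlatAt_of_orbBar_of_morseBott F hJK V U₀ hOrb hMB
  intro U hUf hUg
  have hLpos : (0 : ℝ) < (F.L : ℝ) := Nat.cast_pos.mpr (lt_trans zero_lt_one F.hL.2)
  have hnn : 0 ≤ μ * ((F.L : ℝ)⁻¹) ^ (2 * (K - J)) *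
      (⨅ w : {w : Site (F.P K) 0 → Matrix.specialUnitaryGroup (Fin 2) ℂ |
          ∀ U : GaugeField (F.P K) 0 (Matrix.specialUnitaryGroup (Fin 2) ℂ),
            descendTo F ℰp J K hJK (GaugeField.gaugeAct w U) = descendTo F ℰp J K hJK U},
        ∑ ℓ : PBond (F.P K) 0,
          dist1 (U ℓ * ((GaugeField.gaugeAct (w : Site (F.P K) 0 → Matrix.specialUnitaryGroup (Fin 2) ℂ) U₀) ℓ)⁻¹) ^ 2) :=
    mul_nonneg (mul_pos hμ (pow_pos (inv_pos.mpr hLpos) _)).le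
      (Real.iInf_nonneg fun w => Finset.sum_nonneg fun ℓ _ => sq_nonneg _)
  have := h U hUf hUg
  linarith

end Door

end Summit.QuantumFields.YangMills.Theorems.FluctuationComparisonRegPrIntLGapFlatOfOrbBarMorseBott

end
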